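import Literature.NumberTheory.GaloisRepresentations.TeichmullerCharacter
import Literature.NumberTheory.GaloisRepresentations.ResidualGaloisRepOpenKernel
import Literature.NumberTheory.GaloisRepresentations.AbsolutelyIrreducibleReduction
import Literature.NumberTheory.GaloisRepresentations.DihedralTypeMonomialAnyChar
import Literature.RingTheory.Valuation.AlgClosedResidue
import Literature.NumberTheory.GaloisRepresentations.ResidualRepUnique
import Literature.NumberTheory.GaloisRepresentations.SolvableDihedralCharTwo
import HarnessLib

/-!
# Teichmüller lifts of monomial (induced, dihedral) mod-`p` representations

Theorems only (no definition of a notion, no named fact; D-0026), written by the seat of the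
named fact `Literature.NumberTheory.Automorphic.Allen2014_modularity_nearlyOrdinaryDihedral_Q`
(Allen 2014).  It formalizes the first step of Allen's Lemma 87 (OrdinaryLift), arXiv:1301.1113
p. 70: "We first construct a totally odd dihedral representation `ρ₀ : G_F → GL₂(ℚ̄)` lifting
`ρ̄`.  Write `ρ̄ = Ind_{G_L}^{G_F} χ̄` … Let `χ : G_L → ℚ̄ˣ` denote the Teichmüller lift of `χ̄`
… we set `ρ₁ = Ind_{G_L}^{G_F} χ`" — in the tree's matrix language: a *monomial* representation
`τ : G → GL₂(k̄_p)` (every `τ(g)` diagonal or antidiagonal, the normal form of an irreducible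
dihedral representation, `exists_monomial_of_isDihedralType_of_not_hasCommonEigenvector`) whose
non-zero entries are roots of unity of order prime to `p` lifts, entry by entry through the
Teichmüller section, to a homomorphism `ρ₁ : G → GL₂(ℤ̄_p)` with finite image, the same kernel,
and reduction `τ`.  Here `ℤ̄_p = padicAlgClIntegers p` (valuation ring of `ℚ̄_p = PadicAlgCl p`)
and `k̄_p = padicAlgClResidueField p = ℤ̄_p/𝔪`.

## Main results (all proved)

* `mem_maximalIdeal_padicAlgClIntegers_iff_norm_lt_one`, `residue_eq_residue_iff_norm_sub_lt_one`
  — the dictionary `x ≡ y (mod 𝔪) ↔ ‖x - y‖ < 1` on `ℤ̄_p`.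
* `exists_teichmuller_of_pow_eq_one`, `teichmuller_unique` — **Teichmüller representatives**: for
  `p ∤ n`, every `z ∈ k̄_p` with `z^n = 1` is the residue of a unique `n`-th root of unity of
  `ℤ̄_p` (Serre, *Local Fields* II §4 Prop. 8; from the tree's `exists_pow_eq_one_norm_sub_lt_one`
  and `eq_of_pow_eq_one_of_norm_sub_lt_one`).
* `eq_one_of_pow_prime_pow_eq_one` — `k̄_pˣ` has no `p`-torsion.
* `exists_teichmullerSection` — a map `T : k̄_p → ℤ̄_p` with `T 0 = 0`, `T 1 = 1`, `T z` an
  `n`-th root of unity reducing to `z` whenever `z^n = 1`, multiplicative on such `z`.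
* `exists_monoidHom_integralReduction_eq_of_monomial` — **the Teichmüller lift of a monomial
  representation**: `τ : G →* GL₂(k̄_p)` with every `τ(g)` diagonal or antidiagonal with non-zero
  entries `n`-th roots of unity (`p ∤ n`) is the reduction of a `ρ₁ : G →* GL₂(ℤ̄_p)` with
  `ker ρ₁ = ker τ` whose entries are `0` or `n`-th roots of unity.
* `exists_conjGL_monomial_pow_eq_one` — normalisation: a diagonal-or-antidiagonal `τ` of finite
  exponent `N` becomes, after a diagonal change of frame, monomial with entries `n`-th roots of
  unity, `n` the prime-to-`p` part of `N`.
* `exists_teichmullerLift_of_isDihedralType` — for any group `G`: a `τ : G →* GL₂(k̄_p)` with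
  finite image, no common eigenvector and dihedral projective image is, up to conjugation, the
  reduction of a `ρ₁ : G →* GL₂(ℤ̄_p)` with the same kernel and root-of-unity entries (uses the
  tree's `exists_monomial_of_isDihedralType_of_not_hasCommonEigenvector` over the algebraically
  closed `k̄_p`, `Literature.RingTheory.Valuation.isAlgClosed_residueField`).
* `FramedGaloisRep.finite_range_of_isResidualRepOf`,
  `FramedGaloisRep.exists_artinLift_of_isDihedralType` — the Galois case: a residual
  representation of `ρ : Γ_K → GL₂(ℚ̄_p)` of irreducible dihedral type is a reduction of a
  continuous Artin representation `ρ₁ : Γ_K → GL₂(ℚ̄_p)` with integral values, open kernel equal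
  to `ker ρ̄`, and root-of-unity entries ("`ρ₁ = Ind χ` is a lift of `ρ̄`", Allen loc. cit.).
* `eq_one_or_eq_neg_one_of_mul_self_eq_one`, `two_eq_zero_padicAlgClResidueField_two`,
  `FramedGaloisRep.isOdd_of_isReductionOf_ne_one_two`,
  `FramedGaloisRep.exists_odd_artinLift_of_isDihedralType_two` — at `p = 2`: a
  `ρ₁ : Γ_K → GL₂(ℚ̄₂)` whose reduction is non-trivial at every complex conjugation is odd
  (`ρ₁(c)` is an involution; `det = 1` would make the integral model `±1 ≡ 1 (mod 𝔪)` at `c`),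
  whence an ODD Artin lift when `ρ̄(c) ≠ 1` (Allen, Lemma 87: "If `ρ̄(c) ≠ 1` … we set
  `ρ₁ = Ind χ`", no Serre trick needed).
* `charP_padicAlgClResidueField_two`, `FramedGaloisRep.isDihedralType_residualRep_of_isSolvable_two`,
  `FramedGaloisRep.exists_artinLift_residualRep_of_isSolvable_two` — straight from hypothesis (4)
  of Allen's Introduction Theorem at `p = 2` (`ρ` residually absolutely irreducible with solvable
  residual image): `ρ.residualRep` is a genuine residual representation, irreducible, of finite
  image and of dihedral type, and it has a continuous Artin lift with an integral model (odd as
  soon as `ρ̄(c) ≠ 1`).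

## References

* P. B. Allen, Compositio Math. 150 (2014), Lemma 87 (= arXiv:1301.1113, §5.1.1, p. 70).
  [Allen2014]
* J.-P. Serre, *Local Fields*, GTM 67, Ch. II §4, Prop. 8. [SerreLocalFields1979]
-/

noncomputable section

open scoped MatrixGroups
open Matrix IsLocalRing

namespace Literature.NumberTheory.GaloisRepresentations

variable {p : ℕ} [Fact p.Prime]

/-! ### The dictionary `x ≡ y (mod 𝔪) ↔ ‖x - y‖ < 1` on `ℤ̄_p` -/

section Dictionary

/-- Elements of `ℤ̄_p` have norm `≤ 1`. [folklore] -/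
theorem norm_coe_padicAlgClIntegers_le_one (x : padicAlgClIntegers p) :
    ‖(x : PadicAlgCl p)‖ ≤ 1 :=
  (padicAlgCl_mem_valuationSubring_iff p _).mp x.2

/-- **Membership in the maximal ideal of `ℤ̄_p` is `‖x‖ < 1`** (a norm-one element of the
valuation ring is a unit: its inverse has norm one). [folklore] -/
theorem mem_maximalIdeal_padicAlgClIntegers_iff_norm_lt_one (x : padicAlgClIntegers p) :
    x ∈ maximalIdeal (padicAlgClIntegers p) ↔ ‖(x : PadicAlgCl p)‖ < 1 := by
  rw [mem_maximalIdeal, mem_nonunits_iff]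
  constructor
  · intro hnu
    refine lt_of_le_of_ne (norm_coe_padicAlgClIntegers_le_one x) fun h1 => hnu ?_
    have hx0 : (x : PadicAlgCl p) ≠ 0 := fun h0 => by
      rw [h0, norm_zero] at h1
      exact zero_ne_one h1
    have hinv : (x : PadicAlgCl p)⁻¹ ∈ padicAlgClIntegers p := by
      rw [padicAlgCl_mem_valuationSubring_iff, norm_inv, h1, inv_one]
    exact isUnit_iff_exists_inv.mpr ⟨⟨_, hinv⟩, Subtype.ext (mul_inv_cancel₀ hx0)⟩
  · rintro hlt ⟨w, hw⟩
    have h1 : ((w : padicAlgClIntegers p) : PadicAlgCl p) *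
        (((w⁻¹ : (padicAlgClIntegers p)ˣ) : padicAlgClIntegers p) : PadicAlgCl p) = 1 := by
      rw [← MulMemClass.coe_mul, ← Units.val_mul, mul_inv_cancel, Units.val_one, OneMemClass.coe_one]
    have h2 := congrArg (‖·‖) h1
    simp only [norm_mul, norm_one] at h2
    rw [hw] at h2
    have hle := norm_coe_padicAlgClIntegers_le_one
      ((w⁻¹ : (padicAlgClIntegers p)ˣ) : padicAlgClIntegers p)
    nlinarith [norm_nonneg (x : PadicAlgCl p),
      norm_nonneg ((((w⁻¹ : (padicAlgClIntegers p)ˣ) : padicAlgClIntegers p) : PadicAlgCl p))]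

/-- **`x ≡ y (mod 𝔪) ↔ ‖x - y‖ < 1`** in `ℤ̄_p`. [folklore] -/
theorem residue_eq_residue_iff_norm_sub_lt_one (x y : padicAlgClIntegers p) :
    residue (padicAlgClIntegers p) x = residue (padicAlgClIntegers p) y ↔
      ‖(x : PadicAlgCl p) - (y : PadicAlgCl p)‖ < 1 := by
  rw [← sub_eq_zero, ← map_sub, residue_eq_zero_iff,
    mem_maximalIdeal_padicAlgClIntegers_iff_norm_lt_one, AddSubgroupClass.coe_sub]

end Dictionary

/-! ### Teichmüller representatives in `k̄_p = ℤ̄_p/𝔪` -/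

section Teichmuller

/-- **Teichmüller representatives exist**: every `z ∈ k̄_p` with `z^n = 1` (`n ≥ 1`) is the
residue of an `n`-th root of unity of `ℤ̄_p`. [cite: SerreLocalFields1979, Ch. II §4, Prop. 8] -/
theorem exists_teichmuller_of_pow_eq_one {n : ℕ} (hn0 : 0 < n) {z : padicAlgClResidueField p}
    (hz : z ^ n = 1) :
    ∃ μ : padicAlgClIntegers p, (μ : PadicAlgCl p) ^ n = 1 ∧ residue (padicAlgClIntegers p) μ = z := by
  obtain ⟨w, rfl⟩ := residue_surjective z
  have hwn : ‖(w : PadicAlgCl p) ^ n - 1‖ < 1 := by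
    have h : residue (padicAlgClIntegers p) (w ^ n) = residue (padicAlgClIntegers p) 1 := by
      rw [map_pow, hz, map_one]
    rw [residue_eq_residue_iff_norm_sub_lt_one] at h
    simpa using h
  obtain ⟨μ, hμn, hμ⟩ := exists_pow_eq_one_norm_sub_lt_one hn0 hwn
  have hμmem : μ ∈ padicAlgClIntegers p := by
    rw [padicAlgCl_mem_valuationSubring_iff, PadicAlgCl.norm_eq_one_of_pow_eq_one hn0.ne' hμn]
  refine ⟨⟨μ, hμmem⟩, hμn, ?_⟩
  rw [residue_eq_residue_iff_norm_sub_lt_one, ← norm_neg, neg_sub]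
  exact hμ

/-- **Teichmüller representatives are unique** (`p ∤ n`): two `n`-th roots of unity of `ℤ̄_p`
with the same residue are equal. [cite: SerreLocalFields1979, Ch. II §4, Prop. 8] -/
theorem teichmuller_unique {n : ℕ} (hn0 : 0 < n) (hn : ¬ p ∣ n) {μ ν : padicAlgClIntegers p}
    (hμ : (μ : PadicAlgCl p) ^ n = 1) (hν : (ν : PadicAlgCl p) ^ n = 1)
    (h : residue (padicAlgClIntegers p) μ = residue (padicAlgClIntegers p) ν) : μ = ν := by
  rw [residue_eq_residue_iff_norm_sub_lt_one] at h
  exact Subtype.ext (eq_of_pow_eq_one_of_norm_sub_lt_one hn0 hn hμ hν h)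

/-- **`k̄_pˣ` has no `p`-torsion**: `z^{p^e} = 1 ⇒ z = 1` in the residue field of `ℤ̄_p`
(from the tree's `norm_sub_one_lt_one_of_norm_pow_prime_pow_sub_one_lt_one`). [folklore] -/
theorem eq_one_of_pow_prime_pow_eq_one {z : padicAlgClResidueField p} (e : ℕ)
    (hz : z ^ p ^ e = 1) : z = 1 := by
  obtain ⟨w, rfl⟩ := residue_surjective z
  rw [← map_one (residue (padicAlgClIntegers p)), residue_eq_residue_iff_norm_sub_lt_one,
    OneMemClass.coe_one]
  refine norm_sub_one_lt_one_of_norm_pow_prime_pow_sub_one_lt_one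
    (norm_coe_padicAlgClIntegers_le_one w) e ?_
  have h : residue (padicAlgClIntegers p) (w ^ p ^ e) = residue (padicAlgClIntegers p) 1 := by
    rw [map_pow, hz, map_one]
  rw [residue_eq_residue_iff_norm_sub_lt_one] at h
  simpa using h

/-- Removing the `p`-part of an exponent in `k̄_p`: `z^{p^e m} = 1 ⇒ z^m = 1`. [folklore] -/
theorem pow_eq_one_of_pow_prime_pow_mul_eq_one {z : padicAlgClResidueField p} (e : ℕ) {m : ℕ}
    (hz : z ^ (p ^ e * m) = 1) : z ^ m = 1 := by
  refine eq_one_of_pow_prime_pow_eq_one e ?_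
  rw [← pow_mul, mul_comm, hz]

/-- **The Teichmüller section on `n`-th roots of unity** (`n ≥ 1`, `p ∤ n`): a map
`T : k̄_p → ℤ̄_p` with `T 0 = 0`, `T 1 = 1`, `T z` an `n`-th root of unity with residue `z`
whenever `z^n = 1`, and `T (z z') = T z · T z'` for such `z, z'`.
[cite: SerreLocalFields1979, Ch. II §4, Prop. 8] -/
theorem exists_teichmullerSection {n : ℕ} (hn0 : 0 < n) (hn : ¬ p ∣ n) :
    ∃ T : padicAlgClResidueField p → padicAlgClIntegers p,
      T 0 = 0 ∧ T 1 = 1 ∧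
      (∀ z, z ^ n = 1 → (T z : PadicAlgCl p) ^ n = 1 ∧ residue (padicAlgClIntegers p) (T z) = z) ∧
      ∀ z z', z ^ n = 1 → z' ^ n = 1 → T (z * z') = T z * T z' := by
  classical
  let T : padicAlgClResidueField p → padicAlgClIntegers p := fun z =>
    if h : z ^ n = 1 then (exists_teichmuller_of_pow_eq_one hn0 h).choose else 0
  have hT : ∀ z (h : z ^ n = 1), (T z : PadicAlgCl p) ^ n = 1 ∧
      residue (padicAlgClIntegers p) (T z) = z := fun z h => by
    simp only [T, dif_pos h]
    exact (exists_teichmuller_of_pow_eq_one hn0 h).choose_spec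
  have h0 : ¬ (0 : padicAlgClResidueField p) ^ n = 1 := by
    rw [zero_pow hn0.ne']
    exact zero_ne_one
  refine ⟨T, by simp only [T, dif_neg h0], ?_, hT, fun z z' hz hz' => ?_⟩
  · exact teichmuller_unique hn0 hn (hT 1 (one_pow n)).1 (by simp) ((hT 1 (one_pow n)).2.trans
      (map_one _).symm)
  · have hzz' : (z * z') ^ n = 1 := by rw [mul_pow, hz, hz', one_mul]
    refine teichmuller_unique hn0 hn (hT _ hzz').1 ?_ ?_
    · rw [MulMemClass.coe_mul, mul_pow, (hT z hz).1, (hT z' hz').1, one_mul]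
    · rw [(hT _ hzz').2, map_mul, (hT z hz).2, (hT z' hz').2]

end Teichmuller

/-! ### Monomial `2 × 2` matrices: entrywise multiplicative maps -/

section Monomial

variable {κ : Type*} [CommRing κ] {R : Type*} [CommRing R]

/-- **Entrywise maps are multiplicative on monomial matrices.**  Let `f : κ → R` with `f 0 = 0`
be multiplicative on a multiplicatively meaningful predicate `P` (`f (x y) = f x · f y` for
`P x`, `P y`), and let `A, B` be `2 × 2` matrices each of which is diagonal or antidiagonal with
`P` holding at its two possibly non-zero entries.  Then `f(A B) = f(A) f(B)` entrywise (each entry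
of `A B` is a single product or `0`). [folklore] -/
theorem map_mul_of_monomial (f : κ → R) (hf0 : f 0 = 0) (P : κ → Prop)
    (hf : ∀ x y, P x → P y → f (x * y) = f x * f y) {A B : Matrix (Fin 2) (Fin 2) κ}
    (hA : (A 0 1 = 0 ∧ A 1 0 = 0 ∧ P (A 0 0) ∧ P (A 1 1)) ∨
      (A 0 0 = 0 ∧ A 1 1 = 0 ∧ P (A 0 1) ∧ P (A 1 0)))
    (hB : (B 0 1 = 0 ∧ B 1 0 = 0 ∧ P (B 0 0) ∧ P (B 1 1)) ∨
      (B 0 0 = 0 ∧ B 1 1 = 0 ∧ P (B 0 1) ∧ P (B 1 0))) :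
    (A * B).map f = A.map f * B.map f := by
  ext i j
  rcases hA with ⟨ha01, ha10, pa00, pa11⟩ | ⟨ha00, ha11, pa01, pa10⟩ <;>
  rcases hB with ⟨hb01, hb10, pb00, pb11⟩ | ⟨hb00, hb11, pb01, pb10⟩ <;>
  fin_cases i <;> fin_cases j <;>
  simp [Matrix.mul_apply, Fin.sum_univ_two, Matrix.map_apply, *]

end Monomial

/-! ### The Teichmüller lift of a monomial representation -/

section Lift

variable {G : Type*} [Group G]

/-- **Teichmüller lift of a monomial mod-`p` representation** (Allen 2014, Lemma 87, first step:
"`ρ̄ = Ind χ̄` … `χ` the Teichmüller lift of `χ̄` … `ρ₁ = Ind χ`").  Let `τ : G → GL₂(k̄_p)` be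
*monomial with entries of order dividing `n`*, `p ∤ n`: every `τ(g)` is diagonal or antidiagonal
and its two possibly non-zero entries are `n`-th roots of unity (the normal form of an irreducible
representation of dihedral type, `exists_monomial_of_isDihedralType_of_not_hasCommonEigenvector`,
after the normalisation making one antidiagonal entry `1`).  Then the entrywise Teichmüller lift
is a homomorphism `ρ₁ : G → GL₂(ℤ̄_p)` with reduction `ρ₁ mod 𝔪 = τ`, the same kernel as `τ`
(so the same finite image), and entries `0` or `n`-th roots of unity.
[cite: Allen2014, Lemma 87 (arXiv:1301.1113, §5.1.1, p. 70)] -/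
theorem exists_monoidHom_integralReduction_eq_of_monomial {n : ℕ} (hn0 : 0 < n) (hn : ¬ p ∣ n)
    (τ : G →* GL (Fin 2) (padicAlgClResidueField p))
    (hmono : ∀ g,
      (((τ g : GL (Fin 2) (padicAlgClResidueField p)) : Matrix (Fin 2) (Fin 2) (padicAlgClResidueField p)) 0 1 = 0 ∧
        ((τ g : GL (Fin 2) (padicAlgClResidueField p)) : Matrix (Fin 2) (Fin 2) (padicAlgClResidueField p)) 1 0 = 0 ∧
        ((τ g : GL (Fin 2) (padicAlgClResidueField p)) : Matrix (Fin 2) (Fin 2) (padicAlgClResidueField p)) 0 0 ^ n = 1 ∧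
        ((τ g : GL (Fin 2) (padicAlgClResidueField p)) : Matrix (Fin 2) (Fin 2) (padicAlgClResidueField p)) 1 1 ^ n = 1) ∨
      (((τ g : GL (Fin 2) (padicAlgClResidueField p)) : Matrix (Fin 2) (Fin 2) (padicAlgClResidueField p)) 0 0 = 0 ∧
        ((τ g : GL (Fin 2) (padicAlgClResidueField p)) : Matrix (Fin 2) (Fin 2) (padicAlgClResidueField p)) 1 1 = 0 ∧
        ((τ g : GL (Fin 2) (padicAlgClResidueField p)) : Matrix (Fin 2) (Fin 2) (padicAlgClResidueField p)) 0 1 ^ n = 1 ∧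
        ((τ g : GL (Fin 2) (padicAlgClResidueField p)) : Matrix (Fin 2) (Fin 2) (padicAlgClResidueField p)) 1 0 ^ n = 1)) :
    ∃ ρ₁ : G →* GL (Fin 2) (padicAlgClIntegers p),
      integralReduction (RingHom.id _) ρ₁ = τ ∧ ρ₁.ker = τ.ker ∧
      ∀ g i j, ((ρ₁ g : GL (Fin 2) (padicAlgClIntegers p)) : Matrix (Fin 2) (Fin 2) (padicAlgClIntegers p)) i j = 0 ∨
        ((((ρ₁ g : GL (Fin 2) (padicAlgClIntegers p)) : Matrix (Fin 2) (Fin 2) (padicAlgClIntegers p)) i j :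
          padicAlgClIntegers p) : PadicAlgCl p) ^ n = 1 := by
  obtain ⟨T, hT0, hT1, hT, hTmul⟩ := exists_teichmullerSection (p := p) hn0 hn
  -- entries of `τ g` are `0` or `n`-th roots of unity
  have hentry : ∀ g i j,
      ((τ g : GL (Fin 2) (padicAlgClResidueField p)) : Matrix (Fin 2) (Fin 2) (padicAlgClResidueField p)) i j = 0 ∨
      ((τ g : GL (Fin 2) (padicAlgClResidueField p)) : Matrix (Fin 2) (Fin 2) (padicAlgClResidueField p)) i j ^ n = 1 := by
    intro g i j
    rcases hmono g with ⟨h01, h10, h00, h11⟩ | ⟨h00, h11, h01, h10⟩ <;>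
      fin_cases i <;> fin_cases j <;> simp [*]
  -- the entrywise lift `M g = T ∘ τ g`
  let M : G → Matrix (Fin 2) (Fin 2) (padicAlgClIntegers p) := fun g =>
    ((τ g : GL (Fin 2) (padicAlgClResidueField p)) : Matrix (Fin 2) (Fin 2) (padicAlgClResidueField p)).map T
  have hmul : ∀ g g', M (g * g') = M g * M g' := fun g g' => by
    simp only [M, map_mul, Matrix.GeneralLinearGroup.coe_mul]
    exact map_mul_of_monomial T hT0 (fun z => z ^ n = 1) (fun x y hx hy => hTmul x y hx hy)
      (hmono g) (hmono g')
  have hone : M 1 = 1 := by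
    simp only [M, map_one, Matrix.GeneralLinearGroup.coe_one]
    exact Matrix.map_one T hT0 hT1
  let U : G → GL (Fin 2) (padicAlgClIntegers p) := fun g =>
    ⟨M g, M g⁻¹, by rw [← hmul, mul_inv_cancel, hone], by rw [← hmul, inv_mul_cancel, hone]⟩
  let ρ₁ : G →* GL (Fin 2) (padicAlgClIntegers p) := MonoidHom.mk' U fun g g' => Units.ext (hmul g g')
  have hρ₁ : ∀ g, ((ρ₁ g : GL (Fin 2) (padicAlgClIntegers p)) : Matrix (Fin 2) (Fin 2) (padicAlgClIntegers p)) = M g :=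
    fun g => rfl
  have hres : ∀ z : padicAlgClResidueField p, z = 0 ∨ z ^ n = 1 →
      residue (padicAlgClIntegers p) (T z) = z := by
    rintro z (rfl | hz)
    · rw [hT0, map_zero]
    · exact (hT z hz).2
  have hred : ∀ g, integralReduction (RingHom.id _) ρ₁ g = τ g := fun g => by
    refine Units.ext (Matrix.ext fun i j => ?_)
    rw [integralReduction_apply_coe, RingHom.id_apply, hρ₁]
    exact hres _ (hentry g i j)
  refine ⟨ρ₁, MonoidHom.ext hred, ?_, fun g i j => ?_⟩
  · ext g
    rw [MonoidHom.mem_ker, MonoidHom.mem_ker]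
    constructor
    · intro h
      rw [← hred g]
      change Matrix.GeneralLinearGroup.map _ (ρ₁ g) = 1
      rw [h, map_one]
    · intro h
      apply Units.ext
      rw [hρ₁, Units.val_one]
      simp only [M, h, Units.val_one]
      exact Matrix.map_one T hT0 hT1
  · rw [hρ₁]
    simp only [M, Matrix.map_apply]
    rcases hentry g i j with h | h
    · left
      rw [h, hT0]
    · right
      exact (hT _ h).1

end Lift

/-! ### Normalising a monomial representation of finite exponent -/

section Normalise

variable {G : Type*} [Group G]

/-- Diagonal entries of a power of a diagonal `2 × 2` matrix. [folklore] -/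
theorem pow_apply_of_isDg {k : Type*} [Field k] {A : Matrix (Fin 2) (Fin 2) k} (hA : GL2.IsDg A)
    (N : ℕ) : (A ^ N) 0 0 = A 0 0 ^ N ∧ (A ^ N) 1 1 = A 1 1 ^ N := by
  have e : A = Matrix.diagonal ![A 0 0, A 1 1] := by
    ext i j
    fin_cases i <;> fin_cases j <;> simp [Matrix.diagonal, hA.1, hA.2]
  rw [e, Matrix.diagonal_pow]
  simp

/-- In a finite-exponent representation, the diagonal entries of a diagonal `τ(g)` are roots of
unity of the exponent. [folklore] -/
theorem pow_eq_one_of_isDg {k : Type*} [Field k] {τ : G →* GL (Fin 2) k} {N : ℕ}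
    (hN : ∀ g, τ g ^ N = 1) {g : G} (hg : GL2.IsDg ((τ g : GL (Fin 2) k) : Matrix (Fin 2) (Fin 2) k)) :
    ((τ g : GL (Fin 2) k) : Matrix (Fin 2) (Fin 2) k) 0 0 ^ N = 1 ∧
      ((τ g : GL (Fin 2) k) : Matrix (Fin 2) (Fin 2) k) 1 1 ^ N = 1 := by
  have h := congrArg (fun M : GL (Fin 2) k => (M : Matrix (Fin 2) (Fin 2) k)) (hN g)
  simp only [Units.val_pow_eq_pow_val, Units.val_one] at h
  obtain ⟨h0, h1⟩ := pow_apply_of_isDg hg N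
  refine ⟨?_, ?_⟩
  · rw [← h0, h]; simp
  · rw [← h1, h]; simp

/-- **Normalisation of a monomial representation of finite exponent.**  Let
`τ : G → GL₂(k̄_p)` have every `τ(g)` diagonal or antidiagonal and satisfy `τ(g)^N = 1` for some
`N ≥ 1`.  Then after conjugating by a diagonal matrix (making one antidiagonal entry equal to
`1`) every `τ(g)` is diagonal or antidiagonal with its two possibly non-zero entries `n`-th
roots of unity, where `n` is the prime-to-`p` part of `N` (`k̄_pˣ` has no `p`-torsion).  This is
the hypothesis of `exists_monoidHom_integralReduction_eq_of_monomial`. [folklore] -/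
theorem exists_conjGL_monomial_pow_eq_one (τ : G →* GL (Fin 2) (padicAlgClResidueField p))
    (hshape : ∀ g, GL2.IsDg ((τ g : GL (Fin 2) (padicAlgClResidueField p)) : Matrix (Fin 2) (Fin 2) (padicAlgClResidueField p)) ∨
      GL2.IsAd ((τ g : GL (Fin 2) (padicAlgClResidueField p)) : Matrix (Fin 2) (Fin 2) (padicAlgClResidueField p)))
    (hfin : ∃ N : ℕ, 0 < N ∧ ∀ g, τ g ^ N = 1) :
    ∃ (D : GL (Fin 2) (padicAlgClResidueField p)) (n : ℕ), 0 < n ∧ ¬ p ∣ n ∧ ∀ g,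
      (((conjGL D τ g : GL (Fin 2) (padicAlgClResidueField p)) : Matrix (Fin 2) (Fin 2) (padicAlgClResidueField p)) 0 1 = 0 ∧
        ((conjGL D τ g : GL (Fin 2) (padicAlgClResidueField p)) : Matrix (Fin 2) (Fin 2) (padicAlgClResidueField p)) 1 0 = 0 ∧
        ((conjGL D τ g : GL (Fin 2) (padicAlgClResidueField p)) : Matrix (Fin 2) (Fin 2) (padicAlgClResidueField p)) 0 0 ^ n = 1 ∧
        ((conjGL D τ g : GL (Fin 2) (padicAlgClResidueField p)) : Matrix (Fin 2) (Fin 2) (padicAlgClResidueField p)) 1 1 ^ n = 1) ∨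
      (((conjGL D τ g : GL (Fin 2) (padicAlgClResidueField p)) : Matrix (Fin 2) (Fin 2) (padicAlgClResidueField p)) 0 0 = 0 ∧
        ((conjGL D τ g : GL (Fin 2) (padicAlgClResidueField p)) : Matrix (Fin 2) (Fin 2) (padicAlgClResidueField p)) 1 1 = 0 ∧
        ((conjGL D τ g : GL (Fin 2) (padicAlgClResidueField p)) : Matrix (Fin 2) (Fin 2) (padicAlgClResidueField p)) 0 1 ^ n = 1 ∧
        ((conjGL D τ g : GL (Fin 2) (padicAlgClResidueField p)) : Matrix (Fin 2) (Fin 2) (padicAlgClResidueField p)) 1 0 ^ n = 1) := by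
  obtain ⟨N, hN0, hN⟩ := hfin
  obtain ⟨e, n, hn, hNe⟩ := Nat.exists_eq_pow_mul_and_not_dvd hN0.ne' p (Fact.out : p.Prime).one_lt.ne'
  have hn0 : 0 < n := Nat.pos_of_ne_zero fun h => by rw [h, mul_zero] at hNe; omega
  -- stripping the `p`-part of the exponent
  have strip : ∀ z : (padicAlgClResidueField p), z ^ N = 1 → z ^ n = 1 := fun z hz =>
    pow_eq_one_of_pow_prime_pow_mul_eq_one e (by rw [← hNe]; exact hz)
  -- invertible matrices are not both diagonal and antidiagonal; antidiagonal entries are non-zero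
  have hdet : ∀ (σ : G →* GL (Fin 2) (padicAlgClResidueField p)) (g : G),
      ((σ g : GL (Fin 2) (padicAlgClResidueField p)) : Matrix (Fin 2) (Fin 2) (padicAlgClResidueField p)) 0 0 * ((σ g : GL (Fin 2) (padicAlgClResidueField p)) : Matrix (Fin 2) (Fin 2) (padicAlgClResidueField p)) 1 1 -
        ((σ g : GL (Fin 2) (padicAlgClResidueField p)) : Matrix (Fin 2) (Fin 2) (padicAlgClResidueField p)) 0 1 * ((σ g : GL (Fin 2) (padicAlgClResidueField p)) : Matrix (Fin 2) (Fin 2) (padicAlgClResidueField p)) 1 0 ≠ 0 := by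
    intro σ g
    have h := (σ g).isUnit.map Matrix.detMonoidHom
    rw [Matrix.coe_detMonoidHom, Matrix.det_fin_two] at h
    exact h.ne_zero
  by_cases hall : ∀ g, GL2.IsDg ((τ g : GL (Fin 2) (padicAlgClResidueField p)) : Matrix (Fin 2) (Fin 2) (padicAlgClResidueField p))
  · -- everything diagonal: no normalisation needed
    refine ⟨1, n, hn0, hn, fun g => Or.inl ?_⟩
    have e1 : conjGL 1 τ g = τ g := by rw [conjGL_apply, one_mul, inv_one, mul_one]
    rw [e1]
    obtain ⟨h00, h11⟩ := pow_eq_one_of_isDg hN (hall g)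
    exact ⟨(hall g).1, (hall g).2, strip _ h00, strip _ h11⟩
  · push Not at hall
    obtain ⟨g₀, hg₀⟩ := hall
    have had₀ : GL2.IsAd ((τ g₀ : GL (Fin 2) (padicAlgClResidueField p)) : Matrix (Fin 2) (Fin 2) (padicAlgClResidueField p)) :=
      (hshape g₀).resolve_left hg₀
    set b : (padicAlgClResidueField p) := ((τ g₀ : GL (Fin 2) (padicAlgClResidueField p)) : Matrix (Fin 2) (Fin 2) (padicAlgClResidueField p)) 0 1 with hb
    set c : (padicAlgClResidueField p) := ((τ g₀ : GL (Fin 2) (padicAlgClResidueField p)) : Matrix (Fin 2) (Fin 2) (padicAlgClResidueField p)) 1 0 with hc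
    have hbc : b * c ≠ 0 := by
      have h := hdet τ g₀
      rw [had₀.1, had₀.2, zero_mul, zero_sub, neg_ne_zero] at h
      exact h
    have hb0 : b ≠ 0 := left_ne_zero_of_mul hbc
    -- the normalising diagonal matrix `D = diag(1, b)` and its inverse
    let D : GL (Fin 2) (padicAlgClResidueField p) := Matrix.GeneralLinearGroup.mkOfDetNeZero (Matrix.diagonal ![1, b])
      (by simp [hb0])
    have hD : (D : Matrix (Fin 2) (Fin 2) (padicAlgClResidueField p)) = Matrix.diagonal ![1, b] := rfl
    have hDinv : ((D⁻¹ : GL (Fin 2) (padicAlgClResidueField p)) : Matrix (Fin 2) (Fin 2) (padicAlgClResidueField p)) = Matrix.diagonal ![1, b⁻¹] := by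
      rw [Matrix.coe_units_inv, hD, Matrix.inv_def, Matrix.det_diagonal, Matrix.adjugate_fin_two]
      ext i j
      fin_cases i <;> fin_cases j <;> simp [Matrix.diagonal, hb0]
    -- entries of the conjugate: `(D M D⁻¹)ᵢⱼ = uᵢ Mᵢⱼ wⱼ`
    have hconj : ∀ g (i j : Fin 2), ((conjGL D τ g : GL (Fin 2) (padicAlgClResidueField p)) : Matrix (Fin 2) (Fin 2) (padicAlgClResidueField p)) i j =
        (![1, b] i) * ((τ g : GL (Fin 2) (padicAlgClResidueField p)) : Matrix (Fin 2) (Fin 2) (padicAlgClResidueField p)) i j * (![1, b⁻¹] j) := by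
      intro g i j
      rw [conjGL_apply, Matrix.GeneralLinearGroup.coe_mul, Matrix.GeneralLinearGroup.coe_mul, hD,
        hDinv, Matrix.mul_diagonal, Matrix.diagonal_mul]
    set τ' : G →* GL (Fin 2) (padicAlgClResidueField p) := conjGL D τ with hτ'
    -- shapes are preserved, the exponent is preserved
    have hshape' : ∀ g, GL2.IsDg ((τ' g : GL (Fin 2) (padicAlgClResidueField p)) : Matrix (Fin 2) (Fin 2) (padicAlgClResidueField p)) ∨
        GL2.IsAd ((τ' g : GL (Fin 2) (padicAlgClResidueField p)) : Matrix (Fin 2) (Fin 2) (padicAlgClResidueField p)) := by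
      intro g
      rcases hshape g with h | h
      · left; exact ⟨by rw [hτ', hconj, h.1]; simp, by rw [hτ', hconj, h.2]; simp⟩
      · right; exact ⟨by rw [hτ', hconj, h.1]; simp, by rw [hτ', hconj, h.2]; simp⟩
    have hN' : ∀ g, τ' g ^ N = 1 := fun g => by
      rw [hτ', ← map_pow, conjGL_apply, map_pow, hN g, mul_one, mul_inv_cancel]
    -- the normalised generator `τ' g₀ = (0 1; c' 0)` and `c'^N = 1`
    have h₀00 : ((τ' g₀ : GL (Fin 2) (padicAlgClResidueField p)) : Matrix (Fin 2) (Fin 2) (padicAlgClResidueField p)) 0 0 = 0 := by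
      rw [hτ', hconj, had₀.1]; simp
    have h₀11 : ((τ' g₀ : GL (Fin 2) (padicAlgClResidueField p)) : Matrix (Fin 2) (Fin 2) (padicAlgClResidueField p)) 1 1 = 0 := by
      rw [hτ', hconj, had₀.2]; simp
    have h₀01 : ((τ' g₀ : GL (Fin 2) (padicAlgClResidueField p)) : Matrix (Fin 2) (Fin 2) (padicAlgClResidueField p)) 0 1 = 1 := by
      rw [hτ', hconj, ← hb]; simp [hb0]
    set c' : (padicAlgClResidueField p) := ((τ' g₀ : GL (Fin 2) (padicAlgClResidueField p)) : Matrix (Fin 2) (Fin 2) (padicAlgClResidueField p)) 1 0 with hc'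
    have hsq : GL2.IsDg ((τ' (g₀ * g₀) : GL (Fin 2) (padicAlgClResidueField p)) : Matrix (Fin 2) (Fin 2) (padicAlgClResidueField p)) ∧
        ((τ' (g₀ * g₀) : GL (Fin 2) (padicAlgClResidueField p)) : Matrix (Fin 2) (Fin 2) (padicAlgClResidueField p)) 0 0 = c' := by
      simp only [map_mul, Matrix.GeneralLinearGroup.coe_mul]
      refine ⟨⟨?_, ?_⟩, ?_⟩ <;>
        simp [Matrix.mul_apply, Fin.sum_univ_two, h₀00, h₀11, h₀01, ← hc']
    have hc'N : c' ^ N = 1 := by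
      rw [← hsq.2]
      exact (pow_eq_one_of_isDg hN' hsq.1).1
    refine ⟨D, n, hn0, hn, fun g => ?_⟩
    rw [← hτ']
    rcases hshape' g with hg | hg
    · obtain ⟨h00, h11⟩ := pow_eq_one_of_isDg hN' hg
      exact Or.inl ⟨hg.1, hg.2, strip _ h00, strip _ h11⟩
    · right
      -- `g = h g₀` with `τ' h` diagonal
      set h : G := g * g₀⁻¹ with hh
      have hg' : g = h * g₀ := by rw [hh, inv_mul_cancel_right]
      have hhDg : GL2.IsDg ((τ' h : GL (Fin 2) (padicAlgClResidueField p)) : Matrix (Fin 2) (Fin 2) (padicAlgClResidueField p)) := by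
        rcases hshape' h with hh' | hh'
        · exact hh'
        · -- `τ' h` antidiagonal would make `τ' g = τ' h τ' g₀` diagonal AND antidiagonal
          exfalso
          have hmul : ((τ' g : GL (Fin 2) (padicAlgClResidueField p)) : Matrix (Fin 2) (Fin 2) (padicAlgClResidueField p)) =
              ((τ' h : GL (Fin 2) (padicAlgClResidueField p)) : Matrix (Fin 2) (Fin 2) (padicAlgClResidueField p)) * ((τ' g₀ : GL (Fin 2) (padicAlgClResidueField p)) : Matrix (Fin 2) (Fin 2) (padicAlgClResidueField p)) := by
            rw [hg', map_mul, Matrix.GeneralLinearGroup.coe_mul]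
          have h01 : ((τ' g : GL (Fin 2) (padicAlgClResidueField p)) : Matrix (Fin 2) (Fin 2) (padicAlgClResidueField p)) 0 1 = 0 := by
            rw [hmul]; simp [Matrix.mul_apply, Fin.sum_univ_two, hh'.1, h₀11]
          have h10 : ((τ' g : GL (Fin 2) (padicAlgClResidueField p)) : Matrix (Fin 2) (Fin 2) (padicAlgClResidueField p)) 1 0 = 0 := by
            rw [hmul]; simp [Matrix.mul_apply, Fin.sum_univ_two, hh'.2, h₀00]
          apply hdet τ' g
          rw [hg.1, hg.2, h01, h10]; ring
      obtain ⟨ha, hd⟩ := pow_eq_one_of_isDg hN' hhDg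
      have hmul : ((τ' g : GL (Fin 2) (padicAlgClResidueField p)) : Matrix (Fin 2) (Fin 2) (padicAlgClResidueField p)) =
          ((τ' h : GL (Fin 2) (padicAlgClResidueField p)) : Matrix (Fin 2) (Fin 2) (padicAlgClResidueField p)) * ((τ' g₀ : GL (Fin 2) (padicAlgClResidueField p)) : Matrix (Fin 2) (Fin 2) (padicAlgClResidueField p)) := by
        rw [hg', map_mul, Matrix.GeneralLinearGroup.coe_mul]
      have e01 : ((τ' g : GL (Fin 2) (padicAlgClResidueField p)) : Matrix (Fin 2) (Fin 2) (padicAlgClResidueField p)) 0 1 =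
          ((τ' h : GL (Fin 2) (padicAlgClResidueField p)) : Matrix (Fin 2) (Fin 2) (padicAlgClResidueField p)) 0 0 := by
        rw [hmul]; simp [Matrix.mul_apply, Fin.sum_univ_two, hhDg.1, h₀01, h₀11]
      have e10 : ((τ' g : GL (Fin 2) (padicAlgClResidueField p)) : Matrix (Fin 2) (Fin 2) (padicAlgClResidueField p)) 1 0 =
          ((τ' h : GL (Fin 2) (padicAlgClResidueField p)) : Matrix (Fin 2) (Fin 2) (padicAlgClResidueField p)) 1 1 * c' := by
        rw [hmul]; simp [Matrix.mul_apply, Fin.sum_univ_two, hhDg.2, h₀00, ← hc']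
      refine ⟨hg.1, hg.2, strip _ (by rw [e01, ha]), strip _ ?_⟩
      rw [e10, mul_pow, hd, hc'N, one_mul]

end Normalise

/-! ### Lifting an irreducible representation of dihedral type -/

section Dihedral

variable {G : Type*} [Group G]

/-- The kernel of a conjugate representation. [folklore] -/
theorem ker_conjGL {k : Type*} [CommRing k] {m : Type*} [Fintype m] [DecidableEq m]
    (P : GL m k) (τ : G →* GL m k) : (conjGL P τ).ker = τ.ker := by
  ext g
  rw [MonoidHom.mem_ker, MonoidHom.mem_ker, conjGL_apply]
  constructor
  · intro h
    have h' : P⁻¹ * (P * τ g * P⁻¹) * P = P⁻¹ * 1 * P := by rw [h]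
    simpa [mul_assoc] using h'
  · intro h
    rw [h, mul_one, mul_inv_cancel]

/-- **Teichmüller (Artin) lift of an irreducible representation of dihedral type** (Allen 2014,
Lemma 87, first step; Khare–Wintenberger 2009, proof of Lemma 6.3).  Let `τ : G → GL₂(k̄_p)`
have finite image, no common eigenvector and dihedral projective image.  Then `τ` is, up to
conjugation by some `Q ∈ GL₂(k̄_p)`, the reduction of a homomorphism `ρ₁ : G → GL₂(ℤ̄_p)` with the
same kernel (hence the same finite image size) whose entries are `0` or roots of unity of order
prime to `p` — the induced representation `Ind χ` of the Teichmüller lift `χ` of `χ̄`, in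
matrix form. [cite: Allen2014, Lemma 87 (arXiv:1301.1113, §5.1.1, p. 70)] -/
theorem exists_teichmullerLift_of_isDihedralType (τ : G →* GL (Fin 2) (padicAlgClResidueField p))
    [Finite τ.range] (hce : ¬ HasCommonEigenvector τ) (hτ : IsDihedralType τ) :
    ∃ (ρ₁ : G →* GL (Fin 2) (padicAlgClIntegers p)) (Q : GL (Fin 2) (padicAlgClResidueField p))
      (n : ℕ), 0 < n ∧ ¬ p ∣ n ∧ ρ₁.ker = τ.ker ∧
      (∀ g, τ g = Q * integralReduction (RingHom.id _) ρ₁ g * Q⁻¹) ∧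
      ∀ g i j, ((ρ₁ g : GL (Fin 2) (padicAlgClIntegers p)) : Matrix (Fin 2) (Fin 2) (padicAlgClIntegers p)) i j = 0 ∨
        ((((ρ₁ g : GL (Fin 2) (padicAlgClIntegers p)) : Matrix (Fin 2) (Fin 2) (padicAlgClIntegers p)) i j :
          padicAlgClIntegers p) : PadicAlgCl p) ^ n = 1 := by
  haveI : IsAlgClosed (padicAlgClResidueField p) :=
    Literature.RingTheory.Valuation.isAlgClosed_residueField (padicAlgClIntegers p)
  -- monomial normal form
  obtain ⟨H, P, -, hDg, hAd, -⟩ := exists_monomial_of_isDihedralType_of_not_hasCommonEigenvector τ hce hτ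
  have hshape : ∀ g, GL2.IsDg ((conjGL P τ g : GL (Fin 2) _) : Matrix (Fin 2) (Fin 2) (padicAlgClResidueField p)) ∨
      GL2.IsAd ((conjGL P τ g : GL (Fin 2) _) : Matrix (Fin 2) (Fin 2) (padicAlgClResidueField p)) := fun g => by
    by_cases hg : g ∈ H
    · exact Or.inl (hDg g hg)
    · exact Or.inr (hAd g hg)
  -- finite exponent
  have hfin : ∃ N : ℕ, 0 < N ∧ ∀ g, conjGL P τ g ^ N = 1 := by
    haveI : Nonempty τ.range := ⟨1⟩
    refine ⟨Nat.card τ.range, Nat.card_pos, fun g => ?_⟩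
    have h1 : (⟨τ g, g, rfl⟩ : τ.range) ^ Nat.card τ.range = 1 := pow_card_eq_one'
    have h2 : τ g ^ Nat.card τ.range = 1 := by
      have := congrArg Subtype.val h1
      simpa using this
    rw [← map_pow, conjGL_apply, map_pow, h2, mul_one, mul_inv_cancel]
  obtain ⟨D, n, hn0, hn, hmono⟩ := exists_conjGL_monomial_pow_eq_one (conjGL P τ) hshape hfin
  have e : conjGL D (conjGL P τ) = conjGL (D * P) τ := MonoidHom.ext fun g => by
    simp only [conjGL_apply, _root_.mul_inv_rev]; group
  rw [e] at hmono
  obtain ⟨ρ₁, hred, hker, hroots⟩ :=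
    exists_monoidHom_integralReduction_eq_of_monomial hn0 hn (conjGL (D * P) τ) hmono
  refine ⟨ρ₁, (D * P)⁻¹, n, hn0, hn, by rw [hker, ker_conjGL], fun g => ?_, hroots⟩
  rw [hred, conjGL_apply, inv_inv]
  group

end Dihedral

/-! ### The Galois case: Artin lifts of residual representations of dihedral type -/

section Galois

open Field

/-- A group homomorphism out of a topological group with open kernel is continuous (private
copy, under another name, of `MonoidHom.continuous_of_isOpen_ker` of
`Literature/NumberTheory/Automorphic/LanglandsTetrahedral.lean`, not imported here for layering).
[folklore] -/
private theorem continuous_of_isOpen_ker_aux {G H : Type*} [Group G] [TopologicalSpace G]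
    [IsTopologicalGroup G] [Group H] [TopologicalSpace H] [ContinuousMul H] (f : G →* H)
    (hf : IsOpen (f.ker : Set G)) : Continuous f := by
  apply continuous_of_continuousAt_one f
  rw [ContinuousAt, map_one]
  intro U hU
  rw [Filter.mem_map]
  apply Filter.mem_of_superset (hf.mem_nhds (by simp))
  intro g hg
  rw [SetLike.mem_coe, MonoidHom.mem_ker] at hg
  rw [Set.mem_preimage, hg]
  exact mem_of_mem_nhds hU

variable {K : Type*} [Field K]

/-- **Residual representations have finite image** (in characteristic zero): the kernel of a
residual representation of a continuous `ρ : Γ_K → GL_n(ℚ̄_p)` is open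
(`FramedGaloisRep.isOpen_ker_of_isResidualRepOf`) in the compact group `Γ_K`. [folklore] -/
theorem FramedGaloisRep.finite_range_of_isResidualRepOf [CharZero K] {n : ℕ}
    {ρ : FramedGaloisRep K (PadicAlgCl p) n} {k : Type*} [Field k]
    {ι : padicAlgClResidueField p →+* k} {τ : absoluteGaloisGroup K →* GL (Fin n) k}
    (h : ρ.IsResidualRepOf ι τ) : Finite τ.range := by
  have hopen : IsOpen (τ.ker : Set (absoluteGaloisGroup K)) :=
    FramedGaloisRep.isOpen_ker_of_isResidualRepOf h
  haveI : Finite (absoluteGaloisGroup K ⧸ τ.ker) := Subgroup.quotient_finite_of_isOpen _ hopen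
  exact Finite.of_equiv _ (QuotientGroup.quotientKerEquivRange τ).toEquiv

/-- **Artin lift of a residual representation of dihedral type** (Allen 2014, Lemma 87, first
step, for the residual representation `ρ̄` of a `ρ : Γ_K → GL₂(ℚ̄_p)`): if `τ` is a residual
representation of `ρ` (values in `k̄_p = ℤ̄_p/𝔪`) with no common eigenvector and dihedral
projective image, there is a CONTINUOUS representation `ρ₁ : Γ_K → GL₂(ℚ̄_p)` with values in
`GL₂(ℤ̄_p)` in the standard frame (an Artin representation: open kernel `= ker τ`, finite image),
whose entries are `0` or roots of unity of order prime to `p`, and of which `τ` is a reduction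
(`FramedGaloisRep.IsReductionOf`).  ("`ρ₁ = Ind_{G_L}^{G_F} χ` is a lift of `ρ̄`.")
[cite: Allen2014, Lemma 87 (arXiv:1301.1113, §5.1.1, p. 70)] -/
theorem FramedGaloisRep.exists_artinLift_of_isDihedralType [CharZero K]
    {ρ : FramedGaloisRep K (PadicAlgCl p) 2}
    {τ : absoluteGaloisGroup K →* GL (Fin 2) (padicAlgClResidueField p)}
    (hτ : ρ.IsResidualRepOf (RingHom.id _) τ) (hce : ¬ HasCommonEigenvector τ)
    (hdih : IsDihedralType τ) :
    ∃ (ρ₁ : FramedGaloisRep K (PadicAlgCl p) 2) (ρ₀ : absoluteGaloisGroup K →* GL (Fin 2) (padicAlgClIntegers p))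
      (n : ℕ), 0 < n ∧ ¬ p ∣ n ∧
      (∀ σ, Matrix.GeneralLinearGroup.map (padicAlgClIntegers p).subtype (ρ₀ σ) = ρ₁ σ) ∧
      ρ₀.ker = τ.ker ∧ IsOpen ((ρ₁ : absoluteGaloisGroup K →* GL (Fin 2) (PadicAlgCl p)).ker :
        Set (absoluteGaloisGroup K)) ∧
      ρ₁.IsReductionOf (RingHom.id _) τ ∧
      ∀ σ i j, ((ρ₀ σ : GL (Fin 2) (padicAlgClIntegers p)) : Matrix (Fin 2) (Fin 2) (padicAlgClIntegers p)) i j = 0 ∨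
        ((((ρ₀ σ : GL (Fin 2) (padicAlgClIntegers p)) : Matrix (Fin 2) (Fin 2) (padicAlgClIntegers p)) i j :
          padicAlgClIntegers p) : PadicAlgCl p) ^ n = 1 := by
  haveI : Finite τ.range := FramedGaloisRep.finite_range_of_isResidualRepOf hτ
  obtain ⟨ρ₀, Q, n, hn0, hn, hker, hQ, hroots⟩ := exists_teichmullerLift_of_isDihedralType τ hce hdih
  -- the `ℚ̄_p`-valued Artin representation
  let f : absoluteGaloisGroup K →* GL (Fin 2) (PadicAlgCl p) :=
    (Matrix.GeneralLinearGroup.map (padicAlgClIntegers p).subtype).comp ρ₀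
  have hfker : f.ker = τ.ker := by
    rw [← hker]
    ext σ
    rw [MonoidHom.mem_ker, MonoidHom.mem_ker, MonoidHom.comp_apply]
    constructor
    · intro h
      have hinj : Function.Injective
          (Matrix.GeneralLinearGroup.map (n := Fin 2) (padicAlgClIntegers p).subtype) := by
        intro A B hAB
        refine Units.ext (Matrix.ext fun i j => (padicAlgClIntegers p).subtype_injective ?_)
        have := congrArg (fun M : GL (Fin 2) (PadicAlgCl p) => (M : Matrix (Fin 2) (Fin 2) (PadicAlgCl p)) i j) hAB
        simpa [Matrix.GeneralLinearGroup.map_apply] using this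
      exact hinj (h.trans (map_one _).symm)
    · intro h
      rw [h, map_one]
  have hopen : IsOpen (f.ker : Set (absoluteGaloisGroup K)) := by
    rw [hfker]
    exact FramedGaloisRep.isOpen_ker_of_isResidualRepOf hτ
  let ρ₁ : FramedGaloisRep K (PadicAlgCl p) 2 := ⟨f, continuous_of_isOpen_ker_aux f hopen⟩
  refine ⟨ρ₁, ρ₀, n, hn0, hn, fun σ => rfl, hker, hopen, ?_, hroots⟩
  exact ⟨ρ₀, Q, ⟨1, fun σ => by rw [inv_one, one_mul, mul_one]; rfl⟩, hQ⟩

end Galois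

/-! ### Oddness of Artin lifts at `p = 2` -/

section OddTwo

open Field

/-- An involution of determinant `1` in `GL₂` over a field of characteristic `≠ 2` is `±1`: if
`M² = 1` and `det M = 1` then `M = 1` or `M = -1` (`b (a+d) = c (a+d) = 0`; if `a + d ≠ 0` then
`M` is diagonal with `a² = d² = ad = 1`; if `a + d = 0` then `det M = -(a² + bc) = -1 ≠ 1`).
[folklore] -/
theorem eq_one_or_eq_neg_one_of_mul_self_eq_one {F : Type*} [Field F] (h2 : (2 : F) ≠ 0)
    {M : Matrix (Fin 2) (Fin 2) F} (h : M * M = 1) (hdet : M.det = 1) : M = 1 ∨ M = -1 := by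
  have e := fun i j => congrFun (congrFun h i) j
  have e00 := e 0 0
  have e01 := e 0 1
  have e10 := e 1 0
  have e11 := e 1 1
  simp only [Matrix.mul_apply, Fin.sum_univ_two, Matrix.one_apply_eq, Matrix.one_apply_ne, ne_eq,
    zero_ne_one, one_ne_zero, not_false_eq_true, Fin.isValue] at e00 e01 e10 e11
  rw [Matrix.det_fin_two] at hdet
  by_cases htr : M 0 0 + M 1 1 = 0
  · exfalso
    have hd : M 1 1 = -M 0 0 := by linear_combination htr
    rw [hd] at hdet
    exact h2 (by linear_combination -(hdet + e00))
  · have hb : M 0 1 = 0 := by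
      have : M 0 1 * (M 0 0 + M 1 1) = 0 := by linear_combination e01
      exact (mul_eq_zero.mp this).resolve_right htr
    have hc : M 1 0 = 0 := by
      have : M 1 0 * (M 0 0 + M 1 1) = 0 := by linear_combination e10
      exact (mul_eq_zero.mp this).resolve_right htr
    rw [hb] at e00
    rw [hb, hc] at hdet
    have ha : M 0 0 = 1 ∨ M 0 0 = -1 := by
      have : (M 0 0 - 1) * (M 0 0 + 1) = 0 := by linear_combination e00
      rcases mul_eq_zero.mp this with h1 | h1
      · left; linear_combination h1
      · right; linear_combination h1
    rcases ha with ha | ha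
    · left
      have hd : M 1 1 = 1 := by rw [ha] at hdet; linear_combination hdet
      ext i j; fin_cases i <;> fin_cases j <;> simp [ha, hb, hc, hd]
    · right
      have hd : M 1 1 = -1 := by rw [ha] at hdet; linear_combination -hdet
      ext i j; fin_cases i <;> fin_cases j <;> simp [ha, hb, hc, hd]

/-- `2 = 0` in the residue field `k̄₂ = ℤ̄₂/𝔪` (`‖2‖ < 1`). [folklore] -/
theorem two_eq_zero_padicAlgClResidueField_two :
    (2 : padicAlgClResidueField 2) = 0 := by
  have h : ((2 : ℕ) : padicAlgClResidueField 2) = 0 := by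
    rw [← map_natCast (residue (padicAlgClIntegers 2)) 2, residue_eq_zero_iff,
      mem_maximalIdeal_padicAlgClIntegers_iff_norm_lt_one]
    change ‖((2 : ℕ) : PadicAlgCl 2)‖ < 1
    rw [← map_natCast (algebraMap ℚ_[2] (PadicAlgCl 2)) 2]
    change ‖(((2 : ℕ) : ℚ_[2]) : PadicAlgCl 2)‖ < 1
    rw [PadicAlgCl.norm_extends]
    exact Padic.norm_p_lt_one
  simpa using h

/-- **At `p = 2`, a representation whose reduction is non-trivial at complex conjugation is
odd** (Allen 2014, Lemma 87: "If `ρ̄(c) ≠ 1` for any choice of complex conjugation `c`, we set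
`ρ₁ = Ind χ`", which is then totally odd).  Let `ρ₁ : Γ_K → GL₂(ℚ̄₂)` be continuous with a
reduction `τ` (`FramedGaloisRep.IsReductionOf`, any frame) such that `τ(c) ≠ 1` for every complex
conjugation `c`.  Then `ρ₁` is odd: `ρ₁(c)` is an involution, so `det ρ₁(c) = ±1`, and
`det ρ₁(c) = 1` would force the integral model to be `±1` at `c`, both of which reduce to `1`
modulo `𝔪 ∋ 2`. [cite: Allen2014, Lemma 87 (arXiv:1301.1113, §5.1.1, p. 70)] -/
theorem FramedGaloisRep.isOdd_of_isReductionOf_ne_one_two {K : Type*} [Field K]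
    (ρ₁ : FramedGaloisRep K (PadicAlgCl 2) 2)
    {τ : absoluteGaloisGroup K →* GL (Fin 2) (padicAlgClResidueField 2)}
    (hτ : ρ₁.IsReductionOf (RingHom.id _) τ)
    (hc : ∀ (φ : K →+* ℝ) (c : absoluteGaloisGroup K), IsComplexConjugation φ c → τ c ≠ 1) :
    ρ₁.IsOdd := by
  intro φ c hcc
  obtain ⟨ρ₀, Q, ⟨P, hP⟩, hQ⟩ := hτ
  have hsq : ρ₁ c * ρ₁ c = 1 := by rw [← map_mul, ← sq, hcc.sq_eq_one, map_one]
  -- the integral model at `c`, an involution with the same determinant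
  set M : GL (Fin 2) (PadicAlgCl 2) := P⁻¹ * ρ₁ c * P with hMdef
  have hMsq : M * M = 1 := by
    rw [hMdef]
    calc P⁻¹ * ρ₁ c * P * (P⁻¹ * ρ₁ c * P) = P⁻¹ * (ρ₁ c * ρ₁ c) * P := by group
      _ = 1 := by rw [hsq, mul_one, inv_mul_cancel]
  have hMdet : Matrix.GeneralLinearGroup.det M = Matrix.GeneralLinearGroup.det (ρ₁ c) := by
    rw [hMdef, map_mul, map_mul, map_inv, mul_right_comm, inv_mul_cancel, one_mul]
  -- `det ρ₁(c) = ±1`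
  have hdet2 : Matrix.GeneralLinearGroup.det (ρ₁ c) * Matrix.GeneralLinearGroup.det (ρ₁ c) = 1 := by
    rw [← map_mul, hsq, map_one]
  have hd : ((Matrix.GeneralLinearGroup.det (ρ₁ c) : (PadicAlgCl 2)ˣ) : PadicAlgCl 2) = 1 ∨
      ((Matrix.GeneralLinearGroup.det (ρ₁ c) : (PadicAlgCl 2)ˣ) : PadicAlgCl 2) = -1 := by
    apply mul_self_eq_one_iff.mp
    have h := congrArg Units.val hdet2
    rwa [Units.val_mul, Units.val_one] at h
  rcases hd with h1 | h1
  swap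
  · exact Units.ext (by rw [h1, Units.val_neg, Units.val_one])
  exfalso
  -- `det = 1`: the integral model at `c` is `±1`
  have hM : ((M : GL (Fin 2) (PadicAlgCl 2)) : Matrix (Fin 2) (Fin 2) (PadicAlgCl 2)) = 1 ∨
      ((M : GL (Fin 2) (PadicAlgCl 2)) : Matrix (Fin 2) (Fin 2) (PadicAlgCl 2)) = -1 := by
    refine eq_one_or_eq_neg_one_of_mul_self_eq_one two_ne_zero ?_ ?_
    · rw [← Matrix.GeneralLinearGroup.coe_mul, hMsq, Matrix.GeneralLinearGroup.coe_one]
    · rw [← Matrix.GeneralLinearGroup.val_det_apply, hMdet, h1]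
  have hmapval : ((ρ₀ c : GL (Fin 2) (padicAlgClIntegers 2)) : Matrix (Fin 2) (Fin 2) (padicAlgClIntegers 2)).map
      (padicAlgClIntegers 2).subtype = ((M : GL (Fin 2) (PadicAlgCl 2)) : Matrix (Fin 2) (Fin 2) (PadicAlgCl 2)) := by
    rw [hMdef]
    exact congrArg Units.val (hP c)
  have hinj : Function.Injective fun N : Matrix (Fin 2) (Fin 2) (padicAlgClIntegers 2) =>
      N.map (padicAlgClIntegers 2).subtype :=
    Matrix.map_injective (padicAlgClIntegers 2).subtype_injective
  have hO : ((ρ₀ c : GL (Fin 2) (padicAlgClIntegers 2)) : Matrix (Fin 2) (Fin 2) (padicAlgClIntegers 2)) = 1 ∨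
      ((ρ₀ c : GL (Fin 2) (padicAlgClIntegers 2)) : Matrix (Fin 2) (Fin 2) (padicAlgClIntegers 2)) = -1 := by
    rcases hM with hM | hM
    · left
      apply hinj
      change ((ρ₀ c : GL (Fin 2) (padicAlgClIntegers 2)) : Matrix (Fin 2) (Fin 2) (padicAlgClIntegers 2)).map
          (padicAlgClIntegers 2).subtype =
        (1 : Matrix (Fin 2) (Fin 2) (padicAlgClIntegers 2)).map (padicAlgClIntegers 2).subtype
      rw [hmapval, hM, Matrix.map_one _ (map_zero _) (map_one _)]
    · right
      apply hinj
      change ((ρ₀ c : GL (Fin 2) (padicAlgClIntegers 2)) : Matrix (Fin 2) (Fin 2) (padicAlgClIntegers 2)).map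
          (padicAlgClIntegers 2).subtype =
        (-1 : Matrix (Fin 2) (Fin 2) (padicAlgClIntegers 2)).map (padicAlgClIntegers 2).subtype
      rw [hmapval, hM, Matrix.map_neg, Matrix.map_one _ (map_zero _) (map_one _)]
      exact fun a => map_neg _ a
  -- both `1` and `-1` reduce to `1` modulo `𝔪 ∋ 2`, so `τ(c) = 1`
  have hneg : (-1 : padicAlgClResidueField 2) = 1 := by
    rw [neg_eq_iff_add_eq_zero, one_add_one_eq_two]
    exact two_eq_zero_padicAlgClResidueField_two
  have hred : integralReduction (RingHom.id _) ρ₀ c = 1 := by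
    refine Units.ext (Matrix.ext fun i j => ?_)
    rw [integralReduction_apply_coe, RingHom.id_apply, Matrix.GeneralLinearGroup.coe_one]
    rcases hO with h | h
    · rw [h, Matrix.one_apply, Matrix.one_apply]
      split_ifs
      · rw [map_one]
      · rw [map_zero]
    · rw [h, Matrix.neg_apply, Matrix.one_apply, Matrix.one_apply, map_neg]
      split_ifs
      · rw [map_one, hneg]
      · rw [map_zero, neg_zero]
  apply hc φ c hcc
  rw [hQ c, hred, mul_one, mul_inv_cancel]

/-- **Allen's Lemma 87, first step, at `p = 2` (no Serre trick needed): an ODD Artin lift.**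
For `ρ : Γ_K → GL₂(ℚ̄₂)` with a residual representation `τ` of irreducible dihedral type such
that `τ(c) ≠ 1` for every complex conjugation `c`, the Artin lift of
`FramedGaloisRep.exists_artinLift_of_isDihedralType` is odd ("If `ρ̄(c) ≠ 1` for any choice of
complex conjugation `c`, we set `ρ₁ = Ind χ`" — which is totally odd).
[cite: Allen2014, Lemma 87 (arXiv:1301.1113, §5.1.1, p. 70)] -/
theorem FramedGaloisRep.exists_odd_artinLift_of_isDihedralType_two {K : Type*} [Field K] [CharZero K]
    {ρ : FramedGaloisRep K (PadicAlgCl 2) 2}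
    {τ : absoluteGaloisGroup K →* GL (Fin 2) (padicAlgClResidueField 2)}
    (hτ : ρ.IsResidualRepOf (RingHom.id _) τ) (hce : ¬ HasCommonEigenvector τ)
    (hdih : IsDihedralType τ)
    (hc : ∀ (φ : K →+* ℝ) (c : absoluteGaloisGroup K), IsComplexConjugation φ c → τ c ≠ 1) :
    ∃ (ρ₁ : FramedGaloisRep K (PadicAlgCl 2) 2) (ρ₀ : absoluteGaloisGroup K →* GL (Fin 2) (padicAlgClIntegers 2))
      (n : ℕ), 0 < n ∧ ¬ 2 ∣ n ∧ ρ₁.IsOdd ∧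
      (∀ σ, Matrix.GeneralLinearGroup.map (padicAlgClIntegers 2).subtype (ρ₀ σ) = ρ₁ σ) ∧
      ρ₀.ker = τ.ker ∧ IsOpen ((ρ₁ : absoluteGaloisGroup K →* GL (Fin 2) (PadicAlgCl 2)).ker :
        Set (absoluteGaloisGroup K)) ∧
      ρ₁.IsReductionOf (RingHom.id _) τ ∧
      ∀ σ i j, ((ρ₀ σ : GL (Fin 2) (padicAlgClIntegers 2)) : Matrix (Fin 2) (Fin 2) (padicAlgClIntegers 2)) i j = 0 ∨
        ((((ρ₀ σ : GL (Fin 2) (padicAlgClIntegers 2)) : Matrix (Fin 2) (Fin 2) (padicAlgClIntegers 2)) i j :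
          padicAlgClIntegers 2) : PadicAlgCl 2) ^ n = 1 := by
  obtain ⟨ρ₁, ρ₀, n, hn0, hn, hmap, hker, hopen, hred, hroots⟩ :=
    FramedGaloisRep.exists_artinLift_of_isDihedralType hτ hce hdih
  exact ⟨ρ₁, ρ₀, n, hn0, hn, ρ₁.isOdd_of_isReductionOf_ne_one_two hred hc, hmap, hker, hopen, hred,
    hroots⟩

end OddTwo

/-! ### From Allen's hypothesis (4) at `p = 2`: the Artin lift of `ρ̄` -/

section AllenFour

open Field

/-- `2 ∈ 𝔪` in `ℤ̄₂`. [folklore] -/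
theorem two_mem_maximalIdeal_padicAlgClIntegers :
    ((2 : ℕ) : padicAlgClIntegers 2) ∈ maximalIdeal (padicAlgClIntegers 2) := by
  rw [mem_maximalIdeal_padicAlgClIntegers_iff_norm_lt_one]
  change ‖((2 : ℕ) : PadicAlgCl 2)‖ < 1
  rw [← map_natCast (algebraMap ℚ_[2] (PadicAlgCl 2)) 2]
  change ‖(((2 : ℕ) : ℚ_[2]) : PadicAlgCl 2)‖ < 1
  rw [PadicAlgCl.norm_extends]
  exact Padic.norm_p_lt_one

/-- The residue field `k̄₂ = ℤ̄₂/𝔪` has characteristic `2`. [folklore] -/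
theorem charP_padicAlgClResidueField_two : CharP (padicAlgClResidueField 2) 2 :=
  Literature.RingTheory.Valuation.charP_residueField (padicAlgClIntegers 2)
    two_mem_maximalIdeal_padicAlgClIntegers

variable {K : Type*} [Field K]

/-- **Allen's hypothesis (4) at `p = 2` makes `ρ̄` of irreducible dihedral type**: for
`ρ : Γ_K → GL₂(ℚ̄₂)` residually absolutely irreducible with solvable residual image, the chosen
residual representation `ρ.residualRep` is irreducible (so has no common eigenvector), has finite
image, and has dihedral projective image ("any absolutely irreducible, `2`-dimensional, mod `2`
representation with solvable image is dihedral", Allen 2014, Introduction, p. 2; Dickson /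
Khare–Wintenberger Lemma 6.1 in the tree: `isDihedralType_of_isIrreducible_of_isSolvable_of_charTwo`).
[cite: Allen2014, Introduction (arXiv:1301.1113, p. 2)] -/
theorem FramedGaloisRep.isDihedralType_residualRep_of_isSolvable_two [CharZero K]
    (ρ : FramedGaloisRep K (PadicAlgCl 2) 2) (hres : ρ.IsResiduallyAbsIrreducible)
    (hsol : IsSolvable ρ.residualRep.range) :
    ρ.IsResidualRepOf (RingHom.id _) ρ.residualRep ∧ Finite ρ.residualRep.range ∧
      ¬ HasCommonEigenvector ρ.residualRep ∧ IsDihedralType ρ.residualRep := by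
  obtain ⟨hspec, hirr⟩ := ρ.residualRep_spec_of_isResiduallyAbsIrreducible hres
  haveI : IsAlgClosed (padicAlgClResidueField 2) :=
    Literature.RingTheory.Valuation.isAlgClosed_residueField (padicAlgClIntegers 2)
  haveI : CharP (padicAlgClResidueField 2) 2 := charP_padicAlgClResidueField_two
  haveI hfin : Finite ρ.residualRep.range := FramedGaloisRep.finite_range_of_isResidualRepOf hspec
  exact ⟨hspec, hfin, not_hasCommonEigenvector_of_isIrreducible _ hirr,
    isDihedralType_of_isIrreducible_of_isSolvable_of_charTwo ρ.residualRep hirr hsol⟩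

/-- **Allen 2014, Lemma 87, first step, from hypothesis (4) of the Introduction Theorem**
(`p = 2`): a residually absolutely irreducible `ρ : Γ_K → GL₂(ℚ̄₂)` with solvable residual
image has a continuous Artin lift of its residual representation — `ρ₁ : Γ_K → GL₂(ℚ̄₂)` with an
integral model `ρ₀` in the standard frame, `ker ρ₀ = ker ρ̄` open, entries `0` or roots of unity
of odd order, of which `ρ̄ = ρ.residualRep` is a reduction ("Write `ρ̄ = Ind χ̄` … `ρ₁ = Ind χ`
… `ρ₁` is a lift of `ρ̄`").  Oddness of `ρ₁` when `ρ̄(c) ≠ 1`: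
`FramedGaloisRep.isOdd_of_isReductionOf_ne_one_two`.
[cite: Allen2014, Lemma 87 (arXiv:1301.1113, §5.1.1, p. 70)] -/
theorem FramedGaloisRep.exists_artinLift_residualRep_of_isSolvable_two [CharZero K]
    (ρ : FramedGaloisRep K (PadicAlgCl 2) 2) (hres : ρ.IsResiduallyAbsIrreducible)
    (hsol : IsSolvable ρ.residualRep.range) :
    ∃ (ρ₁ : FramedGaloisRep K (PadicAlgCl 2) 2) (ρ₀ : absoluteGaloisGroup K →* GL (Fin 2) (padicAlgClIntegers 2))
      (n : ℕ), 0 < n ∧ ¬ 2 ∣ n ∧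
      (∀ σ, Matrix.GeneralLinearGroup.map (padicAlgClIntegers 2).subtype (ρ₀ σ) = ρ₁ σ) ∧
      ρ₀.ker = ρ.residualRep.ker ∧ IsOpen ((ρ₁ : absoluteGaloisGroup K →* GL (Fin 2) (PadicAlgCl 2)).ker :
        Set (absoluteGaloisGroup K)) ∧
      ρ₁.IsReductionOf (RingHom.id _) ρ.residualRep ∧
      (∀ σ i j, ((ρ₀ σ : GL (Fin 2) (padicAlgClIntegers 2)) : Matrix (Fin 2) (Fin 2) (padicAlgClIntegers 2)) i j = 0 ∨
        ((((ρ₀ σ : GL (Fin 2) (padicAlgClIntegers 2)) : Matrix (Fin 2) (Fin 2) (padicAlgClIntegers 2)) i j :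
          padicAlgClIntegers 2) : PadicAlgCl 2) ^ n = 1) ∧
      ((∀ (φ : K →+* ℝ) (c : absoluteGaloisGroup K), IsComplexConjugation φ c → ρ.residualRep c ≠ 1) →
        ρ₁.IsOdd) := by
  obtain ⟨hspec, _, hce, hdih⟩ := ρ.isDihedralType_residualRep_of_isSolvable_two hres hsol
  obtain ⟨ρ₁, ρ₀, n, hn0, hn, hmap, hker, hopen, hred, hroots⟩ :=
    FramedGaloisRep.exists_artinLift_of_isDihedralType hspec hce hdih
  exact ⟨ρ₁, ρ₀, n, hn0, hn, hmap, hker, hopen, hred, hroots,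
    fun hc => ρ₁.isOdd_of_isReductionOf_ne_one_two hred hc⟩

end AllenFour

end Literature.NumberTheory.GaloisRepresentations
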